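import Mathlib

/-!
# SoloInformedPageTori — symmetric page tori for the HKM sphere 𝔐₀ (solo-informed s42)

HOME `work/s42/symmetry.md`.  Door D1 for `𝔐₀ = Σ₂(S⁴, τ⁰ρ¹P(-2,3,7))` (arXiv:2402.11706, Q1.4)
asks for a smooth solid torus in `S⁴` or `𝔐₀` bounded by a page torus `T_g = Ṽ + h(g)`,
`g ∈ Γ̃ = π₁Σ(2,3,7) = ⟨a, b ∣ a³ = b⁷ = (ab)²⟩`; a necessary condition is
`Q_g := Γ̃/⟪[k,g]⟫ = 1`, where `k = η = b⁻³ab⁻¹ab⁻³a` is the monodromy class (C425).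

* `soloInformed_oddOrder_inverter`: an element of odd order inverting `c` forces `c² = 1` — the
  algebraic core of PROP Ψ (no orientation-reversing symmetry of the open book is compatible with
  the order-7 or order-3 page torus: the stabiliser `⟨b̄⟩ ≅ ℤ/7` in `Δ(2,3,7)` would have to contain
  an inverter of the hyperbolic class `k̄`); `soloInformed_no_inverter_of_order_seven` is the
  specialisation.
* `soloInformed_comm_inverter`: if `u` inverts `k` then `[k,u] = k²`, so for the order-2 page torus
  preserved by the involution `J` of Rem 9.25 one gets `Q_u = Γ̃/⟪k²⟫`.
* `soloInformed_eta_psl28`, `soloInformed_Q2_nontrivial`: in the Hurwitz quotient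
  `PSL(2,8) < Sym(P¹(𝔽₈)) = Perm (Fin 9)` (`a ↦ v ↦ 1/(v+1)`, `b ↦ v ↦ ω³ + 1/v`, `ω³ = ω + 1`;
  labels `0 ↦ 0`, `ωⁱ ↦ i+1`, `∞ ↦ 8`) the relations `a³ = b⁷ = (ab)² = 1` hold, `η² = 1` and
  `η ≠ 1`.  Hence `Γ̃/⟪η²⟫ ↠ PSL(2,8)`: the `J`-invariant order-2 page torus is knotted (even
  topologically) in `S⁴` and in `𝔐₀`, closing the 'symmetric systems' door of s41 §5 at `e₂` too
  (claims C538–C542).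
-/

namespace Summit.SmoothPoincare4.SmoothPoincare4.Theorems

section algebra

variable {G : Type*} [Group G]

/-- If `v` inverts `c` then `v²` commutes with `c`. -/
theorem soloInformed_sq_comm_of_inverter (v c : G) (h : v * c * v⁻¹ = c⁻¹) :
    Commute (v ^ 2) c := by
  have hvc : v * c = c⁻¹ * v := by
    calc v * c = v * c * v⁻¹ * v := by rw [inv_mul_cancel_right]
      _ = c⁻¹ * v := by rw [h]
  have h' : v * c⁻¹ * v⁻¹ = c := by
    have := congrArg Inv.inv h
    simpa [mul_inv_rev, mul_assoc] using this
  have hvc' : v * c⁻¹ = c * v := by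
    calc v * c⁻¹ = v * c⁻¹ * v⁻¹ * v := by rw [inv_mul_cancel_right]
      _ = c * v := by rw [h']
  show v ^ 2 * c = c * v ^ 2
  rw [pow_two]
  calc v * v * c = v * (v * c) := mul_assoc _ _ _
    _ = v * (c⁻¹ * v) := by rw [hvc]
    _ = v * c⁻¹ * v := (mul_assoc _ _ _).symm
    _ = c * v * v := by rw [hvc']
    _ = c * (v * v) := mul_assoc _ _ _

/-- PROP Ψ, algebraic core: an element of odd order that inverts `c` forces `c ^ 2 = 1`. -/
theorem soloInformed_oddOrder_inverter (v c : G) (n : ℕ)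
    (hv : v ^ (2 * n + 1) = 1) (h : v * c * v⁻¹ = c⁻¹) : c ^ 2 = 1 := by
  have h2 := soloInformed_sq_comm_of_inverter v c h
  have hv' : (v ^ 2) ^ (n + 1) = v := by
    rw [← pow_mul, show 2 * (n + 1) = (2 * n + 1) + 1 by ring, pow_succ, hv, one_mul]
  have hc : Commute v c := by
    have := h2.pow_left (n + 1)
    rwa [hv'] at this
  have e : v * c * v⁻¹ = c := by rw [hc.eq, mul_inv_cancel_right]
  have hcc : c = c⁻¹ := by rw [e] at h; exact h
  rw [pow_two]
  exact mul_eq_one_iff_eq_inv.mpr hcc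

/-- The order-7 stabiliser contains no inverter of an element `c` with `c² ≠ 1`. -/
theorem soloInformed_no_inverter_of_order_seven (b c : G) (m : ℕ)
    (hb : b ^ 7 = 1) (hc : c ^ 2 ≠ 1) : b ^ m * c * (b ^ m)⁻¹ ≠ c⁻¹ := by
  intro h
  have h7 : (b ^ m) ^ (2 * 3 + 1) = 1 := by
    show (b ^ m) ^ 7 = 1
    rw [← pow_mul, mul_comm m 7, pow_mul, hb, one_pow]
  exact hc (soloInformed_oddOrder_inverter (b ^ m) c 3 h7 h)

/-- The same for the order-3 stabiliser. -/
theorem soloInformed_no_inverter_of_order_three (a c : G) (m : ℕ)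
    (ha : a ^ 3 = 1) (hc : c ^ 2 ≠ 1) : a ^ m * c * (a ^ m)⁻¹ ≠ c⁻¹ := by
  intro h
  have h3 : (a ^ m) ^ (2 * 1 + 1) = 1 := by
    show (a ^ m) ^ 3 = 1
    rw [← pow_mul, mul_comm m 3, pow_mul, ha, one_pow]
  exact hc (soloInformed_oddOrder_inverter (a ^ m) c 1 h3 h)

/-- The commutator of `k` with an exact inverter `u` is `k²`; hence `Q_u = Γ̃/⟪k²⟫`. -/
theorem soloInformed_comm_inverter (k u : G) (h : u * k * u⁻¹ = k⁻¹) :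
    k * u * k⁻¹ * u⁻¹ = k ^ 2 := by
  have h' : u * k⁻¹ * u⁻¹ = k := by
    have := congrArg Inv.inv h
    simpa [mul_inv_rev, mul_assoc] using this
  calc k * u * k⁻¹ * u⁻¹ = k * (u * k⁻¹ * u⁻¹) := by simp only [mul_assoc]
    _ = k * k := by rw [h']
    _ = k ^ 2 := (pow_two k).symm

end algebra

/-- The monodromy word `η = b⁻³ a b⁻¹ a b⁻³ a` (class of `Fix ι = K̃`, C425) in any group. -/
def soloInformedEta {G : Type*} [Group G] (a b : G) : G :=
  b⁻¹ ^ 3 * a * b⁻¹ * a * b⁻¹ ^ 3 * a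

/-- Image of `a` in `PSL(2,8)`: the Möbius map `v ↦ 1/(v+1)` of `P¹(𝔽₈)`, as a permutation of
the labels `0 ↦ 0, ωⁱ ↦ i+1, ∞ ↦ 8`. -/
def soloInformedPermA : Equiv.Perm (Fin 9) where
  toFun := ![1, 8, 5, 2, 7, 3, 4, 6, 0]
  invFun := ![8, 0, 3, 5, 6, 2, 7, 4, 1]
  left_inv := fun x => by fin_cases x <;> rfl
  right_inv := fun x => by fin_cases x <;> rfl

/-- Image of `b` in `PSL(2,8)`: the Möbius map `v ↦ ω³ + 1/v`. -/
def soloInformedPermB : Equiv.Perm (Fin 9) where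
  toFun := ![8, 2, 5, 3, 7, 0, 6, 1, 4]
  invFun := ![5, 7, 1, 3, 8, 2, 6, 4, 0]
  left_inv := fun x => by fin_cases x <;> rfl
  right_inv := fun x => by fin_cases x <;> rfl

/-- Hurwitz relations in `PSL(2,8)`: `a³ = b⁷ = (ab)² = 1`, `a ≠ 1`. -/
theorem soloInformed_psl28_hurwitz :
    soloInformedPermA ^ 3 = 1 ∧ soloInformedPermB ^ 7 = 1 ∧
      (soloInformedPermA * soloInformedPermB) ^ 2 = 1 ∧ soloInformedPermA ≠ 1 := by
  decide

/-- The image of `η` in `PSL(2,8)` is an involution. -/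
theorem soloInformed_eta_psl28 :
    soloInformedEta soloInformedPermA soloInformedPermB ^ 2 = 1 ∧
      soloInformedEta soloInformedPermA soloInformedPermB ≠ 1 := by
  decide

/-- Certificate: some group satisfies the `Σ(2,3,7)` relations `a³ = (ab)² = b⁷` (here all `= 1`)
with `η² = 1` but `η ≠ 1`; so `Γ̃/⟪η²⟫ ≠ 1` and the `J`-invariant order-2 page torus is knotted. -/
theorem soloInformed_Q2_nontrivial :
    ∃ a b : Equiv.Perm (Fin 9), a ^ 3 = (a * b) ^ 2 ∧ b ^ 7 = (a * b) ^ 2 ∧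
      soloInformedEta a b ^ 2 = 1 ∧ soloInformedEta a b ≠ 1 := by
  refine ⟨soloInformedPermA, soloInformedPermB, ?_, ?_, ?_, ?_⟩ <;> decide

end Summit.SmoothPoincare4.SmoothPoincare4.Theorems
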